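import Summits.RiemannHypothesis.RiemannHypothesis.Theorems.RuelleBandCofiniteCriticalLineStubBranchesContinuousAux
import Literature.NumberTheory.LFunctions.WeilExplicitContinuous
import Literature.NumberTheory.LFunctions.WeilMellinBounds
import Literature.NumberTheory.LFunctions.WeilSmallSupportPositivity

/-!
# A vanishing two-bump oscillation placed in a node gap
(route `SignCone`, item stmt-RiemannHypothesis-16302 `SignConeOscillatory`; toolkit for
`SignConeSignConeOscillatoryIffInequality.lean`)

Literature-vocabulary lemmas used to show that the oscillatory crux is the whole sign-cone inequality:

* `weilArchPolar_add_const_mul` — linearity `W_ar(F + m G) = W_ar(F) + m W_ar(G)` of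
  `W_ar := weilPolarTerm + weilArchTerm` on test kernels;
* the two-bump witness `w = φ(· + c/2) - φ(· - c/2)` (`φ = WeilContinuous.moll N`, the normalised smooth bump of
  radius `ρ = 1/(N+1)`, written out in full — no new definitions): it is a Weil test supported in
  `[-(c/2 + ρ), c/2 + ρ]`, its autocorrelation `w ⋆ w̃` VANISHES at every `t ≥ 2ρ` with `|t - c| ≥ 2ρ`
  (`weilConv_twoBump_eq_zero`) and is NEGATIVE at `c` (`re_weilConv_twoBump_neg`: `-∫ φ²`);
* `exists_gap_parameters` — for every cutoff `a > 0` a radius index `N` and a height `c > 2a`, `c ≥ log 2`, in the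
  middle of the node gap above `log n > 2a`, at distance `≥ 2ρ` from every node `log m`, `m ≥ 2`.
-/

noncomputable section

-- `Summit.RiemannHypothesis.RiemannHypothesis.…` repeats a namespace component by design (D-0017 layout).
set_option linter.dupNamespace false

open scoped BigOperators ComplexConjugate Topology
open Complex MeasureTheory Set Filter

namespace Summit.RiemannHypothesis.RiemannHypothesis.Theorems.SignCone

open Literature.NumberTheory.LFunctions
open Summit.RiemannHypothesis.RiemannHypothesis.Theorems.RuelleBandCofiniteCriticalLine

/-! ## Linearity of `W_ar = weilPolarTerm + weilArchTerm` on test kernels -/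

/-- `W_ar(F + m G) = W_ar(F) + m W_ar(G)` for test kernels `F, G` and a constant `m`
(`W_ar := weilPolarTerm + weilArchTerm`; the Mellin transform and the archimedean integral are linear, the
latter needs the integrability supplied by `IsWeilTest`). [folklore] -/
theorem weilArchPolar_add_const_mul {F G : ℝ → ℂ} (hF : IsWeilTest F) (hG : IsWeilTest G) (m : ℂ) :
    weilPolarTerm (fun t => F t + m * G t) + weilArchTerm (fun t => F t + m * G t) =
      (weilPolarTerm F + weilArchTerm F) + m * (weilPolarTerm G + weilArchTerm G) := by
  have hH : IsWeilTest (fun t => m * G t) := hG.const_mul m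
  have e : (fun t => F t + m * G t) = F + fun t => m * G t := rfl
  have hM : ∀ s, weilMellin (fun t => F t + m * G t) s = weilMellin F s + m * weilMellin G s := by
    intro s
    rw [e, weilMellin_add hF.1.continuous hF.2 hH.1.continuous hH.2, weilMellin_const_mul]
  have hP : weilPolarTerm (fun t => F t + m * G t) = weilPolarTerm F + m * weilPolarTerm G := by
    simp only [weilPolarTerm, hM]
    ring
  have hAI : weilArchIntegral (fun t => m * G t) = m * weilArchIntegral G := by
    simp only [weilArchIntegral, weilMellin_const_mul]
    rw [← integral_const_mul]
    congr 1 with t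
    ring
  have hA : weilArchTerm (fun t => F t + m * G t) = weilArchTerm F + m * weilArchTerm G := by
    rw [e]
    simp only [weilArchTerm, stub_branchesContinuous_weilArchIntegral_add hF hH, hAI, Pi.add_apply]
    ring
  rw [hP, hA]
  ring

/-- Autocorrelation of a real multiple: `(η g) ⋆ (η g)̃ = η² (g ⋆ g̃)` for real `η` (no hypotheses; compare
`weilQuadratic_const_mul`). [folklore] -/
theorem weilConv_weilReflect_real_mul (η : ℝ) (g : ℝ → ℂ) :
    weilConv (fun t => (η : ℂ) * g t) (weilReflect (fun t => (η : ℂ) * g t)) =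
      fun t => ((η ^ 2 : ℝ) : ℂ) * weilConv g (weilReflect g) t := by
  funext t
  rw [weilConv_apply, weilConv_apply, ← integral_const_mul]
  congr 1 with u
  simp only [weilReflect, map_mul, Complex.conj_ofReal]
  push_cast
  ring

/-! ## The two-bump witness `w = φ(· + c/2) - φ(· - c/2)`

Throughout `φ = WeilContinuous.moll N` (the normalised smooth bump of radius `ρ = 1/(N+1)` centred at `0`,
real and non-negative) and the witness is written out in full (no new definitions). -/

/-- `conj φ = φ` (the mollifier is real). [folklore] -/
theorem conj_moll (N : ℕ) (x : ℝ) : conj (WeilContinuous.moll N x) = WeilContinuous.moll N x := by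
  obtain ⟨r, -, hr⟩ := WeilContinuous.moll_eq_ofReal_nonneg N x
  rw [hr, Complex.conj_ofReal]

/-- Disjoint translates: `φ(x) φ(x - t) = 0` as soon as `2ρ ≤ |t|`. [folklore] -/
theorem moll_mul_moll_sub_eq_zero (N : ℕ) {x t : ℝ} (ht : 2 * (WeilContinuous.bump N).rOut ≤ |t|) :
    WeilContinuous.moll N x * WeilContinuous.moll N (x - t) = 0 := by
  by_cases hx : |x| < (WeilContinuous.bump N).rOut
  · have h2 : (WeilContinuous.bump N).rOut ≤ |x - t| := by
      have h3 : |t| - |x| ≤ |x - t| := by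
        have := abs_sub_abs_le_abs_sub t x
        rwa [abs_sub_comm t x] at this
      linarith
    rw [WeilContinuous.moll_eq_zero h2, mul_zero]
  · rw [WeilContinuous.moll_eq_zero (not_lt.1 hx), zero_mul]

/-- The witness is a Weil test function. [folklore] -/
theorem isWeilTest_twoBump (N : ℕ) (c : ℝ) :
    IsWeilTest (fun u => WeilContinuous.moll N (u + c / 2) - WeilContinuous.moll N (u - c / 2)) := by
  have h1 : IsWeilTest (fun u => WeilContinuous.moll N (u + c / 2)) :=
    isWeilTest_translate (WeilContinuous.isWeilTest_moll N) (c / 2)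
  have h2 : IsWeilTest (fun u => WeilContinuous.moll N (u - c / 2)) := by
    have := isWeilTest_translate (WeilContinuous.isWeilTest_moll N) (-(c / 2))
    simpa only [← sub_eq_add_neg] using this
  exact h1.sub h2

/-- The witness vanishes outside `(-(c/2 + ρ), c/2 + ρ)`. [folklore] -/
theorem twoBump_eq_zero (N : ℕ) {c u : ℝ} (hc : 0 ≤ c) (hu : c / 2 + (WeilContinuous.bump N).rOut ≤ |u|) :
    WeilContinuous.moll N (u + c / 2) - WeilContinuous.moll N (u - c / 2) = 0 := by
  have h1 : (WeilContinuous.bump N).rOut ≤ |u + c / 2| := by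
    rcases le_or_gt 0 u with hu0 | hu0
    · rw [abs_of_nonneg hu0] at hu
      rw [abs_of_nonneg (by linarith)]
      linarith
    · rw [abs_of_neg hu0] at hu
      have : u + c / 2 ≤ -(WeilContinuous.bump N).rOut := by linarith
      calc (WeilContinuous.bump N).rOut ≤ -(u + c / 2) := by linarith
        _ ≤ |u + c / 2| := neg_le_abs _
  have h2 : (WeilContinuous.bump N).rOut ≤ |u - c / 2| := by
    rcases le_or_gt 0 u with hu0 | hu0
    · rw [abs_of_nonneg hu0] at hu
      calc (WeilContinuous.bump N).rOut ≤ u - c / 2 := by linarith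
        _ ≤ |u - c / 2| := le_abs_self _
    · rw [abs_of_neg hu0] at hu
      rw [abs_of_neg (by linarith [(WeilContinuous.bump N).rOut_pos])]
      linarith
  rw [WeilContinuous.moll_eq_zero h1, WeilContinuous.moll_eq_zero h2, sub_zero]

/-- Support of the witness: `tsupport w ⊆ [-(c/2 + ρ), c/2 + ρ]`. [folklore] -/
theorem tsupport_twoBump_subset (N : ℕ) {c : ℝ} (hc : 0 ≤ c) :
    tsupport (fun u => WeilContinuous.moll N (u + c / 2) - WeilContinuous.moll N (u - c / 2)) ⊆
      Icc (-(c / 2 + (WeilContinuous.bump N).rOut)) (c / 2 + (WeilContinuous.bump N).rOut) := by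
  refine closure_minimal (fun u hu => ?_) isClosed_Icc
  rw [Function.mem_support] at hu
  by_contra hu'
  refine hu (twoBump_eq_zero N hc ?_)
  rw [mem_Icc, not_and_or, not_le, not_le] at hu'
  rcases hu' with h | h
  · calc c / 2 + (WeilContinuous.bump N).rOut ≤ -u := by linarith
      _ ≤ |u| := neg_le_abs u
  · exact h.le.trans (le_abs_self u)

/-- The autocorrelation of the witness, unfolded: `(w ⋆ w̃)(t) = ∫ w(u) conj w(u - t) du`. [folklore] -/
theorem weilConv_weilReflect_apply' (w : ℝ → ℂ) (t : ℝ) :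
    weilConv w (weilReflect w) t = ∫ u : ℝ, w u * conj (w (u - t)) := by
  rw [weilConv_apply]
  congr 1 with u
  simp only [weilReflect, neg_sub]

/-- **The witness autocorrelation vanishes away from `0` and `±c`**: if `0 ≤ c`, `2ρ ≤ t` and `2ρ ≤ |t - c|` then
the integrand `w(u) conj w(u - t)` is identically zero, so `(w ⋆ w̃)(t) = 0`. [folklore] -/
theorem weilConv_twoBump_eq_zero (N : ℕ) {c t : ℝ} (hc : 0 ≤ c) (ht : 2 * (WeilContinuous.bump N).rOut ≤ t)
    (htc : 2 * (WeilContinuous.bump N).rOut ≤ |t - c|) :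
    weilConv (fun u => WeilContinuous.moll N (u + c / 2) - WeilContinuous.moll N (u - c / 2))
      (weilReflect (fun u => WeilContinuous.moll N (u + c / 2) - WeilContinuous.moll N (u - c / 2))) t = 0 := by
  rw [weilConv_weilReflect_apply']
  refine integral_eq_zero_of_ae (Eventually.of_forall fun u => ?_)
  have hρ := (WeilContinuous.bump N).rOut_pos
  have ht' : 2 * (WeilContinuous.bump N).rOut ≤ |t| := ht.trans (le_abs_self t)
  -- the four products
  have hP1 : WeilContinuous.moll N (u + c / 2) * WeilContinuous.moll N (u - t + c / 2) = 0 := by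
    have := moll_mul_moll_sub_eq_zero N (x := u + c / 2) ht'
    rwa [show u + c / 2 - t = u - t + c / 2 by ring] at this
  have hP2 : WeilContinuous.moll N (u + c / 2) * WeilContinuous.moll N (u - t - c / 2) = 0 := by
    have htc' : 2 * (WeilContinuous.bump N).rOut ≤ |t + c| := by
      rw [abs_of_nonneg (by linarith)]
      linarith
    have := moll_mul_moll_sub_eq_zero N (x := u + c / 2) htc'
    rwa [show u + c / 2 - (t + c) = u - t - c / 2 by ring] at this
  have hP3 : WeilContinuous.moll N (u - c / 2) * WeilContinuous.moll N (u - t + c / 2) = 0 := by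
    have := moll_mul_moll_sub_eq_zero N (x := u - c / 2) htc
    rwa [show u - c / 2 - (t - c) = u - t + c / 2 by ring] at this
  have hP4 : WeilContinuous.moll N (u - c / 2) * WeilContinuous.moll N (u - t - c / 2) = 0 := by
    have := moll_mul_moll_sub_eq_zero N (x := u - c / 2) ht'
    rwa [show u - c / 2 - t = u - t - c / 2 by ring] at this
  simp only [Pi.zero_apply, map_sub, conj_moll]
  linear_combination hP1 - hP2 - hP3 + hP4

/-- **The witness autocorrelation is negative at `c`**: for `2ρ ≤ c`,
`Re (w ⋆ w̃)(c) = -∫ φ(u - c/2)² du < 0`. [folklore] -/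
theorem re_weilConv_twoBump_neg (N : ℕ) {c : ℝ} (hc : 2 * (WeilContinuous.bump N).rOut ≤ c) :
    (weilConv (fun u => WeilContinuous.moll N (u + c / 2) - WeilContinuous.moll N (u - c / 2))
      (weilReflect (fun u => WeilContinuous.moll N (u + c / 2) - WeilContinuous.moll N (u - c / 2))) c).re
        < 0 := by
  have hρ := (WeilContinuous.bump N).rOut_pos
  have hc0 : 0 ≤ c := by linarith
  set b := WeilContinuous.bump N with hb
  -- the integrand at `t = c` is `-φ(u - c/2)²`
  have hint : ∀ u : ℝ,
      (WeilContinuous.moll N (u + c / 2) - WeilContinuous.moll N (u - c / 2)) *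
          conj (WeilContinuous.moll N (u - c + c / 2) - WeilContinuous.moll N (u - c - c / 2)) =
        -(((b.normed volume (u - c / 2) * b.normed volume (u - c / 2) : ℝ) : ℂ)) := by
    intro u
    have hc' : 2 * (WeilContinuous.bump N).rOut ≤ |c| := hc.trans (le_abs_self c)
    have hP1 : WeilContinuous.moll N (u + c / 2) * WeilContinuous.moll N (u - c + c / 2) = 0 := by
      have := moll_mul_moll_sub_eq_zero N (x := u + c / 2) hc'
      rwa [show u + c / 2 - c = u - c + c / 2 by ring] at this
    have hP2 : WeilContinuous.moll N (u + c / 2) * WeilContinuous.moll N (u - c - c / 2) = 0 := by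
      have h2c : 2 * (WeilContinuous.bump N).rOut ≤ |c + c| := by
        rw [abs_of_nonneg (by linarith)]
        linarith
      have := moll_mul_moll_sub_eq_zero N (x := u + c / 2) h2c
      rwa [show u + c / 2 - (c + c) = u - c - c / 2 by ring] at this
    have hP4 : WeilContinuous.moll N (u - c / 2) * WeilContinuous.moll N (u - c - c / 2) = 0 := by
      have := moll_mul_moll_sub_eq_zero N (x := u - c / 2) hc'
      rwa [show u - c / 2 - c = u - c - c / 2 by ring] at this
    have hP3 : WeilContinuous.moll N (u - c / 2) * WeilContinuous.moll N (u - c + c / 2) =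
        ((b.normed volume (u - c / 2) * b.normed volume (u - c / 2) : ℝ) : ℂ) := by
      rw [show u - c + c / 2 = u - c / 2 by ring]
      simp only [WeilContinuous.moll, hb, Complex.ofReal_mul]
    simp only [map_sub, conj_moll]
    linear_combination hP1 - hP2 - hP3 + hP4
  rw [weilConv_weilReflect_apply']
  simp only [hint, integral_neg, integral_complex_ofReal, Complex.neg_re, Complex.ofReal_re, neg_lt_zero]
  -- positivity of `∫ φ(u - c/2)² du = ∫ φ² > 0`
  rw [integral_sub_right_eq_self (fun u => b.normed volume u * b.normed volume u) (c / 2)]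
  have hcont : Continuous fun u => b.normed volume u * b.normed volume u :=
    b.continuous_normed.mul b.continuous_normed
  refine integral_pos_of_integrable_nonneg_nonzero (x := 0) hcont
    (hcont.integrable_of_hasCompactSupport b.hasCompactSupport_normed.mul_right)
    (fun u => mul_self_nonneg _) ?_
  have h0 : b.normed volume 0 ≠ 0 := by
    have : (0 : ℝ) ∈ Function.support (b.normed volume) := by
      rw [b.support_normed_eq]
      exact Metric.mem_ball_self b.rOut_pos
    exact this
  exact mul_ne_zero h0 h0

/-! ## Gap parameters -/

/-- **Gap parameters.** For every cutoff `a > 0` there are a bump index `N` (radius `ρ = 1/(N+1)`) and a height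
`c` with `2a < c`, `log 2 ≤ c`, `2ρ ≤ c`, and every node `log m` (`m ≥ 2`) at distance `≥ 2ρ` from `c` and of
height `≥ 2ρ`. Choice: `n = ⌊e^{2a}⌋₊ + 1`, `c = (log n + log (n+1))/2` (the middle of the gap above `log n > 2a`),
`N + 1 = 8(n+1)` (so `2ρ = 1/(4(n+1)) ≤ (log (n+1) - log n)/2`). [folklore] -/
theorem exists_gap_parameters {a : ℝ} (ha : 0 < a) :
    ∃ (N : ℕ) (c : ℝ), 2 * a < c ∧ Real.log 2 ≤ c ∧ 2 * (WeilContinuous.bump N).rOut ≤ c ∧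
      (∀ m : ℕ, 2 ≤ m → 2 * (WeilContinuous.bump N).rOut ≤ |Real.log m - c|) ∧
      (∀ m : ℕ, 2 ≤ m → 2 * (WeilContinuous.bump N).rOut ≤ Real.log m) := by
  set n : ℕ := ⌊Real.exp (2 * a)⌋₊ + 1 with hn
  have hn1 : Real.exp (2 * a) < n := by
    rw [hn]
    push_cast
    exact Nat.lt_floor_add_one _
  have hfl : 1 ≤ ⌊Real.exp (2 * a)⌋₊ :=
    Nat.le_floor (by simpa using Real.one_le_exp (by linarith : (0 : ℝ) ≤ 2 * a))
  have hn2 : 2 ≤ n := by omega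
  have hn2' : (2 : ℝ) ≤ n := by exact_mod_cast hn2
  have hnpos : (0 : ℝ) < n := by linarith
  have hlogn : 2 * a < Real.log n := by rwa [Real.lt_log_iff_exp_lt hnpos]
  have hlog2n : Real.log 2 ≤ Real.log n := Real.log_le_log (by norm_num) hn2'
  have hlognn : Real.log n < Real.log (n + 1) := Real.log_lt_log hnpos (by linarith)
  -- the gap `δ = log (n+1) - log n ≥ 1/(n+1)`
  have hδ : 1 / ((n : ℝ) + 1) ≤ Real.log (n + 1) - Real.log n := by
    have h := Real.one_sub_inv_le_log_of_pos (x := ((n : ℝ) + 1) / n) (by positivity)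
    rw [Real.log_div (by positivity) hnpos.ne', inv_div] at h
    have e : 1 - (n : ℝ) / (n + 1) = 1 / ((n : ℝ) + 1) := by
      field_simp
      ring
    linarith
  -- the bump radius
  have hρ : 2 * (WeilContinuous.bump (8 * n + 7)).rOut = 1 / (4 * ((n : ℝ) + 1)) := by
    rw [WeilContinuous.bump_rOut]
    push_cast
    field_simp
    ring
  have hρδ : 1 / (4 * ((n : ℝ) + 1)) ≤ (Real.log (n + 1) - Real.log n) / 2 := by
    have h1 : 1 / (4 * ((n : ℝ) + 1)) ≤ 1 / (2 * ((n : ℝ) + 1)) :=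
      one_div_le_one_div_of_le (by positivity) (by linarith)
    have h2 : 1 / (2 * ((n : ℝ) + 1)) = (1 / ((n : ℝ) + 1)) / 2 := by
      rw [div_div, mul_comm]
    linarith
  have hρ2 : 1 / (4 * ((n : ℝ) + 1)) < Real.log 2 := by
    have h1 : 1 / (4 * ((n : ℝ) + 1)) ≤ 1 / 12 := one_div_le_one_div_of_le (by norm_num) (by linarith)
    have h2 : (1 / 12 : ℝ) < Real.log 2 := by linarith [Real.log_two_gt_d9]
    linarith
  refine ⟨8 * n + 7, (Real.log n + Real.log (n + 1)) / 2, by linarith, by linarith, ?_, ?_, ?_⟩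
  · rw [hρ]
    linarith
  · intro m hm
    rw [hρ]
    have hmpos : (0 : ℝ) < m := by exact_mod_cast (by omega : 0 < m)
    rcases le_or_gt m n with hmn | hmn
    · have hlm : Real.log m ≤ Real.log n := Real.log_le_log hmpos (by exact_mod_cast hmn)
      rw [abs_of_nonpos (by linarith)]
      linarith
    · have hmn' : (n : ℝ) + 1 ≤ m := by exact_mod_cast hmn
      have hlm : Real.log (n + 1) ≤ Real.log m := Real.log_le_log (by positivity) hmn'
      rw [abs_of_nonneg (by linarith)]
      linarith
  · intro m hm
    rw [hρ]
    have hm' : (2 : ℝ) ≤ m := by exact_mod_cast hm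
    have hlm : Real.log 2 ≤ Real.log m := Real.log_le_log (by norm_num) hm'
    linarith

end Summit.RiemannHypothesis.RiemannHypothesis.Theorems.SignCone

end
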